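import Summits.ABC.StewartYu.PadicG3TwoSatSupply
import Summits.ABC.StewartYu.PadicG3TwoEndTwo
import HarnessLib

/-!
# Cell abc-stewartyu, WP-L.P(2) (crux r4 `PadicCoreTwoRat`, stmt-ABC-20504), record: the END SUPPLY of the 𝔑-threaded `2`-adic frame —
# `EndSupplyTwoN C` for every admissible constant function `C` (stub `stub_endTwoN` of line `padic-two-sat-frame`)

`Summits/ABC/StewartYu/PadicG3TwoSatEnd.lean` — cell `abc-stewartyu` (HOME `run/shared/lean/pub/abc-stewartyu/`), route
`YuMatveevShapeRat`, seat p3 (g10, WP-L.P(2) lead).  Theorems only.  Twin of p5's `PadicG3TwoEndTwo` (C1)–(C4) for the schedule of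
record `schedTwoN S F P` of the 𝔑-threaded frame at the LANDED record `P = ParTwo.parTwo V Vmax W` (`Nq = 2^{m+2}`), and the landed END
predicate `ParTwo.recordTwo_parTwo`:
* `T3N_Istar3N_le_T3_Istar3` — the floored decrement at the deeper depth is below p5's `T3 I*` (under the depth fit `T3 I* ≥ 8`), so
  `Nfin_schedTwoS_le_Nfin_schedTwoN` — the END range of `schedTwoN` dominates that of `schedTwoS` and (C2) `end_range_two` transfers;
* `end_order_twoN` — (C3) `(d+2)·S₀N < Tfin I*N` (`Tfin ≥ ⌊M/(n+2)³⌋ + 1`, reserve and floor only add);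
* `L03N_le_L₀`, `L03N_le_D₀` — the `Y₀`-degree `÷ N` is below the record's;
* `Bv3N_Istar_real_le`, `end_vbox_twoN` — (C4) the last VIRTUAL box `2N·sN j/3^{I*N} ≤ (L/Aⱼ + 2)/2^{d+25+m}` is below `P.D j`
  (`3^{I*N} ≥ 2^{d+25+m}·N`, p5's `box_le_record`);
* **`endSupplyTwoN_of`** — `(∀ r, 0 ≤ C r) → (∀ n r, r < n → 256^{n−r}·C r ≤ C n) → EndSupplyTwoN C`.

WHAT THIS IS NOT: the gain/smallness supplies; no crux moves by itself (A1.L not moved).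

References: Yu. V. Nesterenko, LNM 1819 (2003), §5.2 (5.5)–(5.8), (5.13)–(5.22); K. Yu, Acta Math. 211 (2013), (5.13)–(5.16).
-/

noncomputable section

open Finset

namespace Summit.ABC.StewartYu

namespace TwoSetup

variable (S : TwoSetup) (F : S.SatData) (P : PadicG3Par (S.d + 1))

/-! ### The END range -/

/-- `I* ≤ I*N` (the 𝔑-threaded depth is at least p5's). [folklore] -/
theorem Istar3_le_Istar3N : S.Istar3 P ≤ S.Istar3N F P := by
  unfold Istar3 Istar3N
  exact Nat.clog_mono_right 3 (Nat.le_mul_of_pos_right _ F.hN)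

/-- Under the depth fit, the floored decrement at `I*N` is below `T3 I*`. [folklore] -/
theorem T3N_Istar3N_le_T3_Istar3 (hdepth : 8 * 3 ^ S.Istar3 P ≤ 4 * P.L) : S.T3N P (S.Istar3N F P) ≤ S.T3 P (S.Istar3 P) := by
  have h8 : 8 ≤ S.T3 P (S.Istar3 P) := S.T3_ge_of_depth P hdepth le_rfl
  unfold T3N
  refine max_le h8 ?_
  unfold T3
  exact Nat.div_le_div_left (Nat.pow_le_pow_right (by norm_num) (S.Istar3_le_Istar3N F P)) (by positivity)

/-- The END range of `schedTwoN` dominates that of `schedTwoS` (under the depth fit). [folklore] -/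
theorem Nfin_schedTwoS_le_Nfin_schedTwoN (hdepth : 8 * 3 ^ S.Istar3 P ≤ 4 * P.L) :
    (S.schedTwoS P).Nfin (S.Istar3 P) ≤ (S.schedTwoN F P).Nfin (S.Istar3N F P) := by
  rw [S.Nfin_schedTwoS_eq P, schedTwoN_Nfin]
  unfold Xs3N
  refine Nat.mul_le_mul_left _ (Nat.div_le_div_left ?_ (by positivity))
  have := S.T3N_Istar3N_le_T3_Istar3 F P hdepth
  omega

/-- **(C2) for `schedTwoN`**: `(d+2)·Xfin ≤ Nfin I*N` at `Nq = 2^{m+2}`. [cite: Nesterenko2003, §5.2 (5.5); shape only] -/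
theorem end_range_twoN (hNq : P.Nq = 2 ^ (P.m + 2)) :
    (S.d + 1 + 1) * P.Xfin ≤ (S.schedTwoN F P).Nfin (S.schedTwoN F P).Istar := by
  rw [schedTwoN_Istar]
  exact (S.end_range_two P hNq).trans (S.Nfin_schedTwoS_le_Nfin_schedTwoN F P (S.hdepth_two P hNq))

/-! ### The END order -/

/-- **(C3) for `schedTwoN`**: `(d+2)·S₀N < Tfin I*N`. [cite: Nesterenko2003, (5.8); shape only] -/
theorem end_order_twoN : (S.d + 1 + 1) * P.S₀N < (S.schedTwoN F P).Tfin (S.schedTwoN F P).Istar := by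
  have hT := S.Tfin_schedTwoN_ge F P (S.schedTwoN F P).Istar
  unfold PadicG3Par.S₀N
  have h1 : (S.d + 1 + 1) * (P.M / (S.d + 1 + 2) ^ 4) ≤ P.M / (S.d + 1 + 2) ^ 3 := by
    rw [pow_succ, ← Nat.div_div_eq_div_mul]
    calc (S.d + 1 + 1) * (P.M / (S.d + 1 + 2) ^ 3 / (S.d + 1 + 2))
        ≤ (S.d + 1 + 2) * (P.M / (S.d + 1 + 2) ^ 3 / (S.d + 1 + 2)) := Nat.mul_le_mul_right _ (by omega)
      _ ≤ P.M / (S.d + 1 + 2) ^ 3 := by rw [mul_comm]; exact Nat.div_mul_le_self _ _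
  omega

/-! ### The `Y₀`-degree -/

/-- `L03N ≤ L₀` (`⌈x/N⌉ ≤ ⌈x⌉` for `x ≥ 0`, `N ≥ 1`). [folklore] -/
theorem L03N_le_L₀ : S.L03N F P ≤ P.L₀ := by
  unfold L03N PadicG3Par.L₀
  refine Nat.ceil_le_ceil (div_le_self ?_ (by exact_mod_cast F.hN))
  have := PadicG3Par.Cb_pos; have := P.Ω_pos; have := P.K_pos
  positivity

/-- The schedule's `D₀` slot is below the record's. [folklore] -/
theorem L03N_le_D₀ : (S.schedTwoN F P).D₀ ≤ P.D₀ := by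
  rw [schedTwoN_D₀]; exact (S.L03N_le_L₀ F P).trans (S.L₀_le_D₀ P)

/-! ### The last virtual box -/

/-- `Istar3N ≥ 1`. [folklore] -/
theorem Istar3N_pos : 0 < S.Istar3N F P := lt_of_lt_of_le (S.Istar3_pos P) (S.Istar3_le_Istar3N F P)

/-- **The last virtual box as a real**: `Bv3N I*N j ≤ (L/Aⱼ + 2)/2^{d+25+m}` (`3^{I*N} ≥ 2^{d+25+m}·N`). [folklore] -/
theorem Bv3N_Istar_real_le (j : Fin (S.d + 1)) :
    (S.Bv3N F P (S.Istar3N F P) j : ℝ) ≤ ((P.L : ℝ) / P.A j + 2) / 2 ^ (S.d + 1 + 24 + P.m) := by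
  obtain ⟨I, hI⟩ : ∃ I, S.Istar3N F P = I + 1 := ⟨S.Istar3N F P - 1, by have := S.Istar3N_pos F P; omega⟩
  rw [hI, Bv3N_succ, ← hI]
  have hN : (0 : ℝ) < F.N := by exact_mod_cast F.hN
  have hA := P.A_pos j
  have h3 : (2 : ℝ) ^ (S.d + 1 + 24 + P.m) * F.N ≤ (3 : ℝ) ^ S.Istar3N F P := by
    exact_mod_cast S.le_three_pow_Istar3N F P
  have hs : (S.sN P j : ℝ) ≤ (P.L : ℝ) / (2 * P.A j) + 1 := by
    unfold sN; push_cast; linarith [P.side_le j]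
  -- `⌊2(N sN)/3^{I*N}⌋ ≤ 2 N sN / 3^{I*N} ≤ 2 N (L/(2A) + 1)/(2^{d+25+m} N) = (L/A + 2)/2^{d+25+m}`
  have hdiv : ((2 * (F.N * S.sN P j) / 3 ^ S.Istar3N F P : ℕ) : ℝ) ≤ (2 * (F.N * S.sN P j) : ℕ) / (3 : ℝ) ^ S.Istar3N F P := by
    rw [le_div_iff₀ (by positivity)]
    exact_mod_cast Nat.div_mul_le_self (2 * (F.N * S.sN P j)) (3 ^ S.Istar3N F P)
  refine hdiv.trans ?_
  push_cast
  rw [div_le_div_iff₀ (by positivity) (by positivity)]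
  have hnum : 0 ≤ (P.L : ℝ) / P.A j + 2 := by positivity
  calc 2 * ((F.N : ℝ) * S.sN P j) * (2 : ℝ) ^ (S.d + 1 + 24 + P.m)
      ≤ 2 * ((F.N : ℝ) * ((P.L : ℝ) / (2 * P.A j) + 1)) * (2 : ℝ) ^ (S.d + 1 + 24 + P.m) := by gcongr
    _ = ((P.L : ℝ) / P.A j + 2) * ((2 : ℝ) ^ (S.d + 1 + 24 + P.m) * F.N) := by field_simp
    _ ≤ ((P.L : ℝ) / P.A j + 2) * (3 : ℝ) ^ S.Istar3N F P := mul_le_mul_of_nonneg_left h3 hnum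

/-- **(C4) for `schedTwoN`**: the last virtual box is below the record's END box `P.D` at `Nq = 2^{m+2}`.
[cite: Nesterenko2003, §5.2 (5.7); shape only] -/
theorem end_vbox_twoN (hNq : P.Nq = 2 ^ (P.m + 2)) (j : Fin (S.d + 1)) :
    S.Bv3N F P (S.schedTwoN F P).Istar j ≤ P.D j := by
  rw [schedTwoN_Istar]
  unfold PadicG3Par.D
  rw [S.Sdepth_two P hNq, hNq]
  have e : ((2 ^ (P.m + 2) : ℕ) : ℝ) * P.L / (2 ^ (S.d + 1 + 24 + (P.m + 2)) * P.A j) = (P.L : ℝ) / (2 ^ (S.d + 1 + 24) * P.A j) := by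
    have hA := P.A_pos j
    push_cast
    rw [pow_add (2 : ℝ) (S.d + 1 + 24) (P.m + 2)]
    field_simp
  rw [e]
  exact S.box_le_record P (P.A_pos j) (S.Bv3N_Istar_real_le F P j)

/-! ### The END supply -/

/-- **THE END SUPPLY OF THE 𝔑-THREADED `2`-ADIC FRAME** for every constant function `C` with `0 ≤ C r` and `256^{n−r}·C r ≤ C n`
(`r < n`): END data `(P.D₀, P.S₀N, P.Xfin, P.D)` of the landed record `P = ParTwo.parTwo V Vmax W`, the four END lines of `schedTwoN`,
and `RecordTwo` by the landed `ParTwo.recordTwo_parTwo`. [cite: Nesterenko2003, §5.2 (5.13)–(5.22); shape only] -/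
theorem endSupplyTwoN_of {C : ℕ → ℝ} (hC0 : ∀ r, 0 ≤ C r) (hCg : ∀ n r, r < n → (256 : ℝ) ^ (n - r) * C r ≤ C n) :
    EndSupplyTwoN C := by
  intro S F V Vmax W hd hV1 hVmax hW1 _hN
  have hNq : (ParTwo.parTwo V Vmax W hV1 hVmax hW1).Nq = 2 ^ ((ParTwo.parTwo V Vmax W hV1 hVmax hW1).m + 2) := by
    rw [ParTwo.parTwo_Nq, ParTwo.parTwo_m]
  exact ⟨_, _, _, _, S.end_range_twoN F _ hNq, S.end_order_twoN F _, S.L03N_le_D₀ F _, fun j => S.end_vbox_twoN F _ hNq j,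
    ParTwo.recordTwo_parTwo V Vmax W hV1 hVmax hW1 hd hC0 (fun r hr => hCg (S.d + 1) r hr)⟩

end TwoSetup

end Summit.ABC.StewartYu

end
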